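import Summits.ResolutionOfSingularities.ResolutionOfSingularities.Theorems.FrobeniusLadderFInjectiveMacaulayficationOmegaOneCureFanCert
import Summits.ResolutionOfSingularities.ResolutionOfSingularities.Theorems.FrobeniusLadderFInjectiveMacaulayficationFanCheckSound
import Summits.ResolutionOfSingularities.ResolutionOfSingularities.Theorems.FrobeniusLadderFInjectiveMacaulayficationPencilExitTagTransversal
import Summits.ResolutionOfSingularities.ResolutionOfSingularities.Theorems.FrobeniusLadderFInjectiveMacaulayficationPencilExitTagDeepHalf
import Summits.ResolutionOfSingularities.ResolutionOfSingularities.Theorems.FrobeniusLadderFInjectiveMacaulayficationPencilPhiPrimeU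
import HarnessLib

/-!
# TASK 4c LIST BRIDGE (Ω₁ kernel row): from one certified `exitOK` entry of ✓p694236 to `FullCl p` of BOTH pencil charts at every `k`-point of the orbit
# (crux `FInjectiveMacaulayfication` stmt-ResolutionOfSingularities-15315, chain w45a; res-L1-w45a-plan-1 rulings R23.8 / R23.12 «4c = list bridge + local assembly»,
# SOUNDNESS DICTIONARY OF RECORD l.85799/l.85815; seat res-L1-w45a-stub-3 g13; per-code soundness family = res-L1-w45a-stub-1 g14/g15)

[OURS · L1 W4.5a] Support file (`--supports stmt-ResolutionOfSingularities-15315 --as helper`); theorems only; no definitions, no named facts; any field `k` of characteristic `p`.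
Nothing of the crux is proved; no census row is asserted here (the assembled LOCAL ROW over the three certified fans is the companion file `…OmegaLocalCureRow`). AI-written
(AI review is weaker than expert review).
-/

set_option linter.dupNamespace false

noncomputable section

open AlgebraicGeometry IsLocalRing MvPolynomial
open scoped Pointwise

namespace Summit.ResolutionOfSingularities.ResolutionOfSingularities.Theorems.FInjectiveMacaulayfication.OmegaExitBridge

open Summit.ResolutionOfSingularities.ResolutionOfSingularities.Theorems.FInjectiveMacaulayfication
open FanCheckKit FanCheckSound OmegaOneCureFanCert SliceableCentre

/-! ## §1 Semantics of the list primitives of `exitOK` -/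

section Lists

/-- Length of `vmin`. [folklore] -/
theorem length_vmin (a b : List ℕ) : (vmin a b).length = min a.length b.length := by
  simp [vmin]

/-- Length of `vsub`. [folklore] -/
theorem length_vsub (a b : List ℕ) : (vsub a b).length = min a.length b.length := by
  simp [vsub]

/-- Entries of a `zip`-`map` of two lists of equal length. [folklore] -/
theorem getL_map_zip (f : ℕ × ℕ → ℕ) (hf : f (0, 0) = 0) : ∀ (a b : List ℕ), a.length = b.length → ∀ i : ℕ,
    getL ((a.zip b).map f) i 0 = f (getL a i 0, getL b i 0)
  | [], [], _, i => by rw [List.zip_nil_left, List.map_nil, getL_nil]; exact hf.symm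
  | [], _ :: _, h, _ => absurd h (by simp)
  | _ :: _, [], h, _ => absurd h (by simp)
  | x :: xs, y :: ys, _, 0 => rfl
  | x :: xs, y :: ys, h, i + 1 => by
    rw [List.zip_cons_cons, List.map_cons, getL_cons_succ, getL_cons_succ, getL_cons_succ]
    exact getL_map_zip f hf xs ys (by simpa using h) i

/-- Entries of `vmin` (equal lengths). [folklore] -/
theorem getL_vmin (a b : List ℕ) (h : a.length = b.length) (i : ℕ) : getL (vmin a b) i 0 = min (getL a i 0) (getL b i 0) :=
  getL_map_zip (fun x => min x.1 x.2) rfl a b h i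

/-- Entries of `vsub` (equal lengths). [folklore] -/
theorem getL_vsub (a b : List ℕ) (h : a.length = b.length) (i : ℕ) : getL (vsub a b) i 0 = getL a i 0 - getL b i 0 :=
  getL_map_zip (fun x => x.1 - x.2) rfl a b h i

/-- Entries of `vadd` (equal lengths). [folklore] -/
theorem getL_vadd (a b : List ℕ) (h : a.length = b.length) (i : ℕ) : getL (vadd a b) i 0 = getL a i 0 + getL b i 0 :=
  getL_map_zip (fun x => x.1 + x.2) rfl a b h i

/-- `vadd` of two restrictions to `Z` is the restriction of the pointwise sum. [folklore] -/
theorem vadd_map (Z : List ℕ) (f g : ℕ → ℕ) : vadd (Z.map f) (Z.map g) = Z.map fun j => f j + g j := by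
  induction Z with
  | nil => rfl
  | cons j Z ih =>
    rw [List.map_cons, List.map_cons, List.map_cons, ← ih]
    rfl

/-- `onZ` is a `map`. [plumbing] -/
theorem onZ_eq_map (Z v : List ℕ) : onZ Z v = Z.map fun j => getL v j 0 := rfl

/-- `allLe (Z.map f) b` says `f j ≤ b` on `Z`. [folklore] -/
theorem allLe_map (Z : List ℕ) (f : ℕ → ℕ) (b : ℕ) (h : allLe (Z.map f) b = true) : ∀ j ∈ Z, f j ≤ b := by
  intro j hj
  simp only [allLe, List.all_map, List.all_eq_true, Function.comp, Nat.ble_eq] at h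
  exact h j hj

/-- `allLe (onZ Z v) b` says `v_j ≤ b` on `Z`. [folklore] -/
theorem allLe_onZ (Z v : List ℕ) (b : ℕ) (h : allLe (onZ Z v) b = true) : ∀ j ∈ Z, getL v j 0 ≤ b :=
  allLe_map Z _ b h

/-- `allLe (vadd (onZ Z v) (onZ Z w)) b` says `v_j + w_j ≤ b` on `Z`. [folklore] -/
theorem allLe_vadd_onZ (Z v w : List ℕ) (b : ℕ) (h : allLe (vadd (onZ Z v) (onZ Z w)) b = true) : ∀ j ∈ Z, getL v j 0 + getL w j 0 ≤ b := by
  rw [onZ_eq_map, onZ_eq_map, vadd_map] at h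
  exact allLe_map Z _ b h

/-- `allLe (vadd (vadd (onZ Z u) (onZ Z v)) (onZ Z w)) b` says `u_j + v_j + w_j ≤ b` on `Z`. [folklore] -/
theorem allLe_vadd_vadd_onZ (Z u v w : List ℕ) (b : ℕ) (h : allLe (vadd (vadd (onZ Z u) (onZ Z v)) (onZ Z w)) b = true) :
    ∀ j ∈ Z, getL u j 0 + getL v j 0 + getL w j 0 ≤ b := by
  rw [onZ_eq_map, onZ_eq_map, onZ_eq_map, vadd_map, vadd_map] at h
  exact allLe_map Z _ b h

/-- The «some positive entry on `Z`» test. [folklore] -/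
theorem any_onZ_pos_iff (Z v : List ℕ) : ((onZ Z v).any fun x => Nat.blt 0 x) = true ↔ ∃ j ∈ Z, 0 < getL v j 0 := by
  simp [onZ, List.any_eq_true]

/-- The «some non-`Z` letter passes `F`» test. [folklore] -/
theorem any_offZ (n : ℕ) (Z : List ℕ) (F : ℕ → Bool) (h : (((List.range n).filter fun i => !(Z.any fun j => Nat.beq j i)).any F) = true) :
    ∃ i, i < n ∧ i ∉ Z ∧ F i = true := by
  rw [List.any_eq_true] at h
  obtain ⟨i, hi, hF⟩ := h
  rw [List.mem_filter, List.mem_range] at hi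
  refine ⟨i, hi.1, fun hiZ => ?_, hF⟩
  have h2 := hi.2
  rw [Bool.not_eq_true', List.any_eq_false] at h2
  exact h2 i hiZ (by simp)

/-- Two lists of equal length that differ, differ at some index. [folklore] -/
theorem exists_getL_ne_of_ne (a b : List ℕ) (hlen : a.length = b.length) (h : a ≠ b) : ∃ i, i < a.length ∧ getL a i 0 ≠ getL b i 0 := by
  by_contra hcon
  push Not at hcon
  exact h (List.ext_getElem hlen fun i h₁ h₂ => by rw [← getL_eq_getElem a i 0 h₁, ← getL_eq_getElem b i 0 h₂]; exact hcon i h₁)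

/-- Members of an `all`-checked `zip` at a common index. [folklore] -/
theorem all_zip_getL {α β : Type} (l₁ : List α) (l₂ : List β) (d₁ : α) (d₂ : β) (F : α × β → Bool) (h : ((l₁.zip l₂).all F) = true)
    (i : ℕ) (h₁ : i < l₁.length) (h₂ : i < l₂.length) : F (getL l₁ i d₁, getL l₂ i d₂) = true := by
  rw [List.all_eq_true] at h
  exact h _ (mk_getL_mem_zip l₁ l₂ d₁ d₂ i h₁ h₂)

end Lists

/-! ## §2 The exponent data of a cone chart, entrywise

For the rows `ρ₁, …, ρ_L` of a cone: `C_i = e·ρ_i[CI]`, `A_i = ⟨ρ_i, P⟩`, `B_i = ⟨ρ_i, Q⟩`, `m = min(A,B)`, `G = min(C,m)`, `M₁ = C − G`, `M₂ = m − G`, `r = A − m`, `s = B − m` (the `let`s of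
✓p694236 `exitOK`). -/

section Data

variable (e CI : ℕ) (P Q : List ℕ) (rows : List (List ℕ))

/-- Entry `i` of the boundary column `C`. [plumbing] -/
theorem getL_colC (i : ℕ) : getL (rows.map fun ρ => e * getL ρ CI 0) i 0 = e * getL (getL rows i []) CI 0 :=
  getL_map_of_apply_default _ [] 0 (by rw [getL_nil, mul_zero]) rows i

/-- Entry `i` of a weight column `A = ⟨ρ_i, P⟩`. [plumbing] -/
theorem getL_colA (i : ℕ) : getL (rows.map fun ρ => dotL ρ P) i 0 = dotL (getL rows i []) P :=
  getL_map_of_apply_default _ [] 0 (by cases P <;> rfl) rows i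

/-- ★ **THE FOUR EXPONENT VECTORS ENTRYWISE**: with `Cᵢ, Aᵢ, Bᵢ` as above, `M₁ᵢ = Cᵢ − min(Cᵢ, min(Aᵢ,Bᵢ))`, `M₂ᵢ = min(Aᵢ,Bᵢ) − min(Cᵢ, min(Aᵢ,Bᵢ))`, `rᵢ = Aᵢ − min(Aᵢ,Bᵢ)`,
`sᵢ = Bᵢ − min(Aᵢ,Bᵢ)` (every index `i`; past the end everything is `0`). [plumbing] -/
theorem exitData_getL (i : ℕ) :
    getL (vsub (rows.map fun ρ => e * getL ρ CI 0) (vmin (rows.map fun ρ => e * getL ρ CI 0) (vmin (rows.map fun ρ => dotL ρ P) (rows.map fun ρ => dotL ρ Q)))) i 0 =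
        e * getL (getL rows i []) CI 0 - min (e * getL (getL rows i []) CI 0) (min (dotL (getL rows i []) P) (dotL (getL rows i []) Q)) ∧
      getL (vsub (vmin (rows.map fun ρ => dotL ρ P) (rows.map fun ρ => dotL ρ Q))
          (vmin (rows.map fun ρ => e * getL ρ CI 0) (vmin (rows.map fun ρ => dotL ρ P) (rows.map fun ρ => dotL ρ Q)))) i 0 =
        min (dotL (getL rows i []) P) (dotL (getL rows i []) Q) - min (e * getL (getL rows i []) CI 0) (min (dotL (getL rows i []) P) (dotL (getL rows i []) Q)) ∧
      getL (vsub (rows.map fun ρ => dotL ρ P) (vmin (rows.map fun ρ => dotL ρ P) (rows.map fun ρ => dotL ρ Q))) i 0 =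
        dotL (getL rows i []) P - min (dotL (getL rows i []) P) (dotL (getL rows i []) Q) ∧
      getL (vsub (rows.map fun ρ => dotL ρ Q) (vmin (rows.map fun ρ => dotL ρ P) (rows.map fun ρ => dotL ρ Q))) i 0 =
        dotL (getL rows i []) Q - min (dotL (getL rows i []) P) (dotL (getL rows i []) Q) := by
  have hC : (rows.map fun ρ => e * getL ρ CI 0).length = rows.length := List.length_map _
  have hA : (rows.map fun ρ => dotL ρ P).length = rows.length := List.length_map _
  have hB : (rows.map fun ρ => dotL ρ Q).length = rows.length := List.length_map _
  have hm : (vmin (rows.map fun ρ => dotL ρ P) (rows.map fun ρ => dotL ρ Q)).length = rows.length := by rw [length_vmin, hA, hB, min_self]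
  have hG : (vmin (rows.map fun ρ => e * getL ρ CI 0) (vmin (rows.map fun ρ => dotL ρ P) (rows.map fun ρ => dotL ρ Q))).length = rows.length := by
    rw [length_vmin, hC, hm, min_self]
  have em : getL (vmin (rows.map fun ρ => dotL ρ P) (rows.map fun ρ => dotL ρ Q)) i 0 = min (dotL (getL rows i []) P) (dotL (getL rows i []) Q) := by
    rw [getL_vmin _ _ (hA.trans hB.symm), getL_colA, getL_colA]
  have eG : getL (vmin (rows.map fun ρ => e * getL ρ CI 0) (vmin (rows.map fun ρ => dotL ρ P) (rows.map fun ρ => dotL ρ Q))) i 0 =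
      min (e * getL (getL rows i []) CI 0) (min (dotL (getL rows i []) P) (dotL (getL rows i []) Q)) := by
    rw [getL_vmin _ _ (hC.trans hm.symm), getL_colC, em]
  refine ⟨?_, ?_, ?_, ?_⟩
  · rw [getL_vsub _ _ (hC.trans hG.symm), getL_colC, eG]
  · rw [getL_vsub _ _ (hm.trans hG.symm), em, eG]
  · rw [getL_vsub _ _ (hA.trans hm.symm), getL_colA, em]
  · rw [getL_vsub _ _ (hB.trans hm.symm), getL_colA, em]

end Data

/-! ## §3 Unpacking the traversal of ✓p694236 `checkExits` -/

/-- ★ **ONE CERTIFIED ENTRY**: `checkExits … = true` gives `exitOK` at every (cone index, orbit index) with the tabulated tag. [bookkeeping] -/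
theorem exitOK_of_checkExits (n e CI : ℕ) (P Q : List ℕ) (RAYS CONES ORB TAGS : List (List ℕ)) (h : checkExits n e CI P Q RAYS CONES ORB TAGS = true)
    (j : ℕ) (hj : j < CONES.length) (m : ℕ) (hm : m < ORB.length) :
    exitOK n e CI P Q (raysOf RAYS (getL CONES j [])) (getL ORB m []) (getL (getL TAGS j []) m 0) = true := by
  unfold checkExits at h
  rw [Bool.and_eq_true, Nat.beq_eq] at h
  have h1 := all_zip_getL CONES TAGS [] [] _ h.2 j hj (h.1 ▸ hj)
  dsimp only at h1
  rw [Bool.and_eq_true, Nat.beq_eq] at h1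
  have h2 := all_zip_getL ORB (getL TAGS j []) [] 0 _ h1.2 m hm (h1.1 ▸ hm)
  exact h2

/-- `exitOK` is `false` on codes `≥ 9`. [plumbing] -/
theorem exitOK_lt_nine (n e CI : ℕ) (P Q : List ℕ) (rows : List (List ℕ)) (Z : List ℕ) (t : ℕ) (h : exitOK n e CI P Q rows Z t = true) : t < 9 := by
  by_contra ht
  obtain ⟨u, rfl⟩ : ∃ u, t = u + 9 := ⟨t - 9, by omega⟩
  simp [exitOK] at h


/-! ## §4 The orbit dictionary: `Z = {i : c i = 0}` -/

section Orbit

variable {k : Type} [Field k] {n : ℕ} (Z : List ℕ) (c : Fin n → k) (hZ : ∀ i : Fin n, c i = 0 ↔ (i : ℕ) ∈ Z) (hZn : ∀ j ∈ Z, j < n)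

/-- `expOf` entrywise. [plumbing] -/
theorem expOf_apply' (n : ℕ) (l : List ℕ) (i : Fin n) : expOf n l i = getL l i 0 := by
  rw [expOf, Finsupp.coe_equivFunOnFinite_symm]; rfl

include hZ in
/-- A bound checked on `Z` holds at every letter with `c i = 0`. [plumbing] -/
theorem le_of_allLe_onZ (v : Fin n →₀ ℕ) (L : List ℕ) (hv : ∀ i : Fin n, v i = getL L i 0) (b : ℕ) (h : allLe (onZ Z L) b = true) :
    ∀ i, c i = 0 → v i ≤ b :=
  fun i hci => by rw [hv i]; exact allLe_onZ Z L b h _ ((hZ i).1 hci)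

include hZ in
/-- A bound on a sum of two vectors checked on `Z`. [plumbing] -/
theorem add_le_of_allLe_onZ (v v' : Fin n →₀ ℕ) (L L' : List ℕ) (hv : ∀ i : Fin n, v i = getL L i 0) (hv' : ∀ i : Fin n, v' i = getL L' i 0) (b : ℕ)
    (h : allLe (vadd (onZ Z L) (onZ Z L')) b = true) : ∀ i, c i = 0 → v i + v' i ≤ b :=
  fun i hci => by rw [hv i, hv' i]; exact allLe_vadd_onZ Z L L' b h _ ((hZ i).1 hci)

include hZ in
/-- A bound on a sum of three vectors checked on `Z`. [plumbing] -/
theorem add_add_le_of_allLe_onZ (u v w : Fin n →₀ ℕ) (Lu Lv Lw : List ℕ) (hu : ∀ i : Fin n, u i = getL Lu i 0) (hv : ∀ i : Fin n, v i = getL Lv i 0)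
    (hw : ∀ i : Fin n, w i = getL Lw i 0) (b : ℕ) (h : allLe (vadd (vadd (onZ Z Lu) (onZ Z Lv)) (onZ Z Lw)) b = true) : ∀ i, c i = 0 → u i + v i + w i ≤ b :=
  fun i hci => by rw [hu i, hv i, hw i]; exact allLe_vadd_vadd_onZ Z Lu Lv Lw b h _ ((hZ i).1 hci)

include hZ hZn in
/-- The «some positive entry on `Z`» test read on the vector: `¬ (v|_Z = 0)`. [plumbing] -/
theorem any_onZ_pos_iff_not_forall (v : Fin n →₀ ℕ) (L : List ℕ) (hv : ∀ i : Fin n, v i = getL L i 0) :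
    ((onZ Z L).any fun x => Nat.blt 0 x) = true ↔ ¬ ∀ i, c i = 0 → v i = 0 := by
  rw [any_onZ_pos_iff]
  constructor
  · rintro ⟨j, hjZ, hj⟩ hall
    have h0 := hall ⟨j, hZn j hjZ⟩ ((hZ ⟨j, hZn j hjZ⟩).2 hjZ)
    rw [hv] at h0
    dsimp only at h0
    omega
  · intro h
    push Not at h
    obtain ⟨i, hci, hvi⟩ := h
    refine ⟨i, (hZ i).1 hci, ?_⟩
    rw [← hv i]
    exact Nat.pos_of_ne_zero hvi

include hZ hZn in
/-- The extra letter of codes 5/6 read on the vectors. [plumbing] -/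
theorem exists_letter_of_onZ (v w : Fin n →₀ ℕ) (L L' : List ℕ) (hv : ∀ i : Fin n, v i = getL L i 0) (hw : ∀ i : Fin n, w i = getL L' i 0)
    (h : ∃ j ∈ Z, getL L j 0 ≠ 0 ∧ getL L' j 0 = 0) : ∃ i, c i = 0 ∧ v i ≠ 0 ∧ w i = 0 := by
  obtain ⟨j, hjZ, h1, h2⟩ := h
  refine ⟨⟨j, hZn j hjZ⟩, (hZ _).2 hjZ, ?_, ?_⟩
  · rw [hv]; exact h1
  · rw [hw]; exact h2

end Orbit

/-! ## §5 Shared consequences of the exponent bookkeeping: `M₁ ⊥ M₂`, `r ⊥ s`, `r ≠ s`, and the two-unit letter -/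

section Shared

/-- ★ **DISJOINTNESS AND `r ≠ s` FROM THE LISTS**: if `M₁ M₂ r s : Fin n →₀ ℕ` are the exit lists entrywise and the two weight columns differ, then `M₁ ⊥ M₂`, `r ⊥ s`, `r ≠ s`
(the hypotheses of ✓p697613 `prime_pencilPhiW` / ✓p700612 `prime_pencilPhiU`). [plumbing] -/
theorem exitData_props {n : ℕ} (e CI : ℕ) (P Q : List ℕ) (rows : List (List ℕ)) (hn : rows.length = n)
    (hAB : (rows.map fun ρ => dotL ρ P) ≠ (rows.map fun ρ => dotL ρ Q)) (M₁ M₂ r s : Fin n →₀ ℕ)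
    (hM₁ : ∀ i : Fin n, M₁ i = getL (vsub (rows.map fun ρ => e * getL ρ CI 0) (vmin (rows.map fun ρ => e * getL ρ CI 0) (vmin (rows.map fun ρ => dotL ρ P) (rows.map fun ρ => dotL ρ Q)))) i 0)
    (hM₂ : ∀ i : Fin n, M₂ i = getL (vsub (vmin (rows.map fun ρ => dotL ρ P) (rows.map fun ρ => dotL ρ Q))
      (vmin (rows.map fun ρ => e * getL ρ CI 0) (vmin (rows.map fun ρ => dotL ρ P) (rows.map fun ρ => dotL ρ Q)))) i 0)
    (hr : ∀ i : Fin n, r i = getL (vsub (rows.map fun ρ => dotL ρ P) (vmin (rows.map fun ρ => dotL ρ P) (rows.map fun ρ => dotL ρ Q))) i 0)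
    (hs : ∀ i : Fin n, s i = getL (vsub (rows.map fun ρ => dotL ρ Q) (vmin (rows.map fun ρ => dotL ρ P) (rows.map fun ρ => dotL ρ Q))) i 0) :
    (∀ i, M₁ i = 0 ∨ M₂ i = 0) ∧ (∀ i, r i = 0 ∨ s i = 0) ∧ r ≠ s := by
  have hdat := fun i : ℕ => exitData_getL e CI P Q rows i
  have cM₁ := fun i : Fin n => (hM₁ i).trans (hdat i).1
  have cM₂ := fun i : Fin n => (hM₂ i).trans (hdat i).2.1
  have cr := fun i : Fin n => (hr i).trans (hdat i).2.2.1
  have cs := fun i : Fin n => (hs i).trans (hdat i).2.2.2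
  refine ⟨fun i => by rw [cM₁, cM₂]; omega, fun i => by rw [cr, cs]; omega, ?_⟩
  obtain ⟨i, hi, hAB'⟩ := exists_getL_ne_of_ne _ _ (by rw [List.length_map, List.length_map]) hAB
  rw [List.length_map, hn] at hi
  rw [getL_colA, getL_colA] at hAB'
  intro hrs'
  have h1 := cr ⟨i, hi⟩
  have h2 := cs ⟨i, hi⟩
  rw [hrs'] at h1
  rw [h1] at h2
  dsimp only at h2
  omega

variable (k : Type) [Field k]

/-- ★ **THE TWO-UNIT LETTER**: the third `nonpdiv` disjunct of `exitOK` («some `i ∉ Z` with `1 ≤ |rᵢ − sᵢ| ≤ 4`») gives, for `p ≥ 5`, a letter `i₁` with `c i₁ ≠ 0` and `rᵢ₁ ≠ sᵢ₁` in `k`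
(the hypothesis of ✓p700517 `…_twoUnit_all`; ✓ `natCast_ne_natCast_of_small`). [plumbing] -/
theorem twoUnit_letter (p : ℕ) [Fact p.Prime] [CharP k p] (hp5 : 5 ≤ p) {n : ℕ} (P Q : List ℕ) (rows : List (List ℕ)) (Z : List ℕ)
    (c : Fin n → k) (hZ : ∀ i : Fin n, c i = 0 ↔ (i : ℕ) ∈ Z) (r s : Fin n →₀ ℕ)
    (hr : ∀ i : Fin n, r i = getL (vsub (rows.map fun ρ => dotL ρ P) (vmin (rows.map fun ρ => dotL ρ P) (rows.map fun ρ => dotL ρ Q))) i 0)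
    (hs : ∀ i : Fin n, s i = getL (vsub (rows.map fun ρ => dotL ρ Q) (vmin (rows.map fun ρ => dotL ρ P) (rows.map fun ρ => dotL ρ Q))) i 0)
    (h : (((List.range n).filter fun i => !(Z.any fun j => Nat.beq j i)).any fun i =>
      Nat.ble 1 ((getL (vsub (rows.map fun ρ => dotL ρ P) (vmin (rows.map fun ρ => dotL ρ P) (rows.map fun ρ => dotL ρ Q))) i 0 -
          getL (vsub (rows.map fun ρ => dotL ρ Q) (vmin (rows.map fun ρ => dotL ρ P) (rows.map fun ρ => dotL ρ Q))) i 0) +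
        (getL (vsub (rows.map fun ρ => dotL ρ Q) (vmin (rows.map fun ρ => dotL ρ P) (rows.map fun ρ => dotL ρ Q))) i 0 -
          getL (vsub (rows.map fun ρ => dotL ρ P) (vmin (rows.map fun ρ => dotL ρ P) (rows.map fun ρ => dotL ρ Q))) i 0)) &&
      Nat.ble ((getL (vsub (rows.map fun ρ => dotL ρ P) (vmin (rows.map fun ρ => dotL ρ P) (rows.map fun ρ => dotL ρ Q))) i 0 -
          getL (vsub (rows.map fun ρ => dotL ρ Q) (vmin (rows.map fun ρ => dotL ρ P) (rows.map fun ρ => dotL ρ Q))) i 0) +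
        (getL (vsub (rows.map fun ρ => dotL ρ Q) (vmin (rows.map fun ρ => dotL ρ P) (rows.map fun ρ => dotL ρ Q))) i 0 -
          getL (vsub (rows.map fun ρ => dotL ρ P) (vmin (rows.map fun ρ => dotL ρ P) (rows.map fun ρ => dotL ρ Q))) i 0)) 4) = true) :
    ∃ i₁ : Fin n, c i₁ ≠ 0 ∧ (r i₁ : k) ≠ (s i₁ : k) := by
  obtain ⟨i₁, hi₁n, hi₁Z, hF⟩ := any_offZ n Z _ h
  rw [Bool.and_eq_true, Nat.ble_eq, Nat.ble_eq] at hF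
  refine ⟨⟨i₁, hi₁n⟩, fun h0 => hi₁Z ((hZ _).1 h0), ?_⟩
  rw [hr, hs]
  exact PencilExitTagTransversal.natCast_ne_natCast_of_small k p hp5 _ _ hF

end Shared

end Summit.ResolutionOfSingularities.ResolutionOfSingularities.Theorems.FInjectiveMacaulayfication.OmegaExitBridge

end
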